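import Literature.Combinatorics.Additive.TripleProductProperty
import Summits.MatrixMultiplication.MatrixMultiplication.Theorems.SnSubsetDichotomyThresholdSubsetTriplesChainDefs

/-!
# `SnSubsetDichotomy.ThresholdSubsetTriples`, line `interleaved-subsignature-ascent` — cross-level design rules R1, R2

Census c3b §3 of crux `stmt-MatrixMultiplication-10882` (lead seat `prover-line-…-10882-1`), kernel-checked.  The simplest
CROSS-LEVEL necessary conditions for the triple product property of three top-extended classes
`(starPiece E₁ N * L₁, starPiece E₂ N * L₂, starPiece E₃ N * L₃)` (lower sets `Lᵢ` fixing the token `N`), namely the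
instances of the line's `LevelCondition` with exactly ONE non-trivial lower quotient:

* `stub_designRuleR1` (3-cycles): if the lower quotient set `L₁L₁⁻¹` contains the 3-cycle `x ↦ y ↦ z ↦ x`
  (`a a'⁻¹ = swap x z * swap x y`), the first class uses the direction `x` and the second class uses BOTH directions
  `y, z` at the token `N`, then the TPP fails — witness `s = swap(x,N)a`, `s' = swap(x,N)a'`, `t = swap(y,N)b`,
  `t' = swap(z,N)b`, `u = u'`: `s s'⁻¹ · t t'⁻¹ = (N y z)(N z y) = 1` with `s ≠ s'`.
* `designRuleR2` (transpositions): if `swap x y ∈ L₁L₁⁻¹`, the first class uses `x` and the second uses `y` AND the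
  identity letter `N`, the TPP fails — witness `t = swap(y,N)b`, `t' = b`: `(N y)(N y) = 1`.

These rules are the OWNERSHIP / EXCLUSION mechanism visible in every optimum of the hub (census c3b §1: a class whose
lower quotient set contains the 3-cycles of a block and which uses a direction in that block expels the other classes
from the block).  Elementary swap algebra (`Equiv.swap_apply_apply`, `Equiv.swap_comm`, `Equiv.swap_mul_self`).
-/

-- `Summit.<Summit>.<Problem>` is the tree's mandated summit-side namespace; for this single-conjunct summit the
-- two components coincide, so the file silences `dupNamespace` (same as the vocabulary file it imports).
set_option linter.dupNamespace false
set_option autoImplicit false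

namespace Summit.MatrixMultiplication.MatrixMultiplication.Theorems.ThresholdSubsetTriples

open scoped Pointwise
open Literature.Combinatorics.Additive

variable {α : Type*} [DecidableEq α] [Fintype α]

omit [Fintype α] in
/-- Conjugating a star letter: `swap x N * swap x w * swap x N = swap N w` for `w ∉ {x, N}`. -/
theorem swap_conj_star (x N w : α) (hwx : w ≠ x) (hwN : w ≠ N) :
    Equiv.swap x N * Equiv.swap x w * Equiv.swap x N = Equiv.swap N w := by
  have h := Equiv.swap_apply_apply (Equiv.swap x N) x w
  rw [Equiv.swap_apply_left, Equiv.swap_apply_of_ne_of_ne hwx hwN, Equiv.swap_inv] at h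
  exact h.symm

/-- **Design rule R1 (stub `stub_designRuleR1`, census c3b §3).**  Token `N`; lower sets `L₁ ∋ a, a'` with
`a a'⁻¹` the 3-cycle `x ↦ y ↦ z ↦ x` (`= swap x z * swap x y`), `L₂ ∋ b`, `L₃ ∋ c`; directions `x ∈ E₁`,
`y, z ∈ E₂` and some `e ∈ E₃`; `x, y, z` distinct and `y, z ≠ N`.  Then the top-extended triple does NOT have the
triple product property. -/
theorem stub_designRuleR1 {α : Type*} [DecidableEq α] [Fintype α] (N x y z e : α) (E₁ E₂ E₃ : Finset α) (L₁ L₂ L₃ : Finset (Equiv.Perm α)) (a a' b c : Equiv.Perm α) (ha : a ∈ L₁) (ha' : a' ∈ L₁) (hb : b ∈ L₂) (hc : c ∈ L₃) (hq : a * a'⁻¹ = Equiv.swap x z * Equiv.swap x y) (hx : x ∈ E₁) (hy : y ∈ E₂) (hz : z ∈ E₂) (he : e ∈ E₃) (hxy : x ≠ y) (hxz : x ≠ z) (hyz : y ≠ z) (hyN : y ≠ N) (hzN : z ≠ N) : ¬ TripleProductProperty (starPiece E₁ N * L₁) (starPiece E₂ N * L₂) (starPiece E₃ N * L₃) := by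
  intro hT
  have hs : Equiv.swap x N * a ∈ starPiece E₁ N * L₁ :=
    Finset.mul_mem_mul (mem_starPiece.2 ⟨x, hx, rfl⟩) ha
  have hs' : Equiv.swap x N * a' ∈ starPiece E₁ N * L₁ :=
    Finset.mul_mem_mul (mem_starPiece.2 ⟨x, hx, rfl⟩) ha'
  have ht : Equiv.swap y N * b ∈ starPiece E₂ N * L₂ :=
    Finset.mul_mem_mul (mem_starPiece.2 ⟨y, hy, rfl⟩) hb
  have ht' : Equiv.swap z N * b ∈ starPiece E₂ N * L₂ :=
    Finset.mul_mem_mul (mem_starPiece.2 ⟨z, hz, rfl⟩) hb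
  have hu : Equiv.swap e N * c ∈ starPiece E₃ N * L₃ :=
    Finset.mul_mem_mul (mem_starPiece.2 ⟨e, he, rfl⟩) hc
  -- the two conjugated letters of the 3-cycle
  have h1 : Equiv.swap x N * Equiv.swap x z * Equiv.swap x N = Equiv.swap N z :=
    swap_conj_star x N z hxz.symm hzN
  have h2 : Equiv.swap x N * Equiv.swap x y * Equiv.swap x N = Equiv.swap N y :=
    swap_conj_star x N y hxy.symm hyN
  have hrel : Equiv.swap x N * a * (Equiv.swap x N * a')⁻¹ *
      (Equiv.swap y N * b * (Equiv.swap z N * b)⁻¹) *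
      (Equiv.swap e N * c * (Equiv.swap e N * c)⁻¹) = 1 := by
    have step1 : Equiv.swap x N * a * (Equiv.swap x N * a')⁻¹ =
        Equiv.swap x N * (a * a'⁻¹) * Equiv.swap x N := by
      rw [mul_inv_rev, Equiv.swap_inv]; group
    have step2 : Equiv.swap y N * b * (Equiv.swap z N * b)⁻¹ = Equiv.swap y N * Equiv.swap z N := by
      rw [mul_inv_rev, Equiv.swap_inv]; group
    rw [step1, step2, mul_inv_cancel, mul_one, hq]
    have step3 : Equiv.swap x N * (Equiv.swap x z * Equiv.swap x y) * Equiv.swap x N =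
        Equiv.swap N z * Equiv.swap N y := by
      calc Equiv.swap x N * (Equiv.swap x z * Equiv.swap x y) * Equiv.swap x N
          = (Equiv.swap x N * Equiv.swap x z * Equiv.swap x N) *
              (Equiv.swap x N * Equiv.swap x y * Equiv.swap x N) := by
            simp only [mul_assoc, Equiv.swap_mul_self_mul]
        _ = Equiv.swap N z * Equiv.swap N y := by rw [h1, h2]
    rw [step3, Equiv.swap_comm y N, Equiv.swap_comm z N]
    calc Equiv.swap N z * Equiv.swap N y * (Equiv.swap N y * Equiv.swap N z)
        = Equiv.swap N z * (Equiv.swap N y * Equiv.swap N y) * Equiv.swap N z := by group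
      _ = 1 := by rw [Equiv.swap_mul_self, mul_one, Equiv.swap_mul_self]
  obtain ⟨hss, -, -⟩ := hT _ hs _ hs' _ ht _ ht' _ hu _ hu hrel
  have haa : a = a' := mul_left_cancel hss
  have h3 : Equiv.swap x z * Equiv.swap x y = 1 := by rw [← hq, haa, mul_inv_cancel]
  -- but the 3-cycle moves `x`
  have h4 := congrArg (fun π : Equiv.Perm α => π x) h3
  simp only [Equiv.Perm.mul_apply, Equiv.swap_apply_left, Equiv.Perm.one_apply] at h4
  rw [Equiv.swap_apply_of_ne_of_ne hxy.symm hyz] at h4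
  exact hxy h4.symm

/-- **Design rule R2 (census c3b §3).**  Token `N`; `a a'⁻¹ = swap x y ∈ L₁L₁⁻¹`, `x ∈ E₁`, `y ∈ E₂` and the
identity letter `N ∈ E₂`, `L₂, L₃, E₃` non-empty, `x ≠ y ≠ N`: the top-extended triple is not TPP
(witness `t = swap(y,N)b`, `t' = swap(N,N)b = b`). -/
theorem designRuleR2 (N x y e : α) (E₁ E₂ E₃ : Finset α) (L₁ L₂ L₃ : Finset (Equiv.Perm α))
    (a a' b c : Equiv.Perm α) (ha : a ∈ L₁) (ha' : a' ∈ L₁) (hb : b ∈ L₂) (hc : c ∈ L₃)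
    (hq : a * a'⁻¹ = Equiv.swap x y) (hx : x ∈ E₁) (hy : y ∈ E₂) (hN : N ∈ E₂) (he : e ∈ E₃)
    (hxy : x ≠ y) (hyN : y ≠ N) :
    ¬ TripleProductProperty (starPiece E₁ N * L₁) (starPiece E₂ N * L₂) (starPiece E₃ N * L₃) := by
  intro hT
  have hs : Equiv.swap x N * a ∈ starPiece E₁ N * L₁ :=
    Finset.mul_mem_mul (mem_starPiece.2 ⟨x, hx, rfl⟩) ha
  have hs' : Equiv.swap x N * a' ∈ starPiece E₁ N * L₁ :=
    Finset.mul_mem_mul (mem_starPiece.2 ⟨x, hx, rfl⟩) ha'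
  have ht : Equiv.swap y N * b ∈ starPiece E₂ N * L₂ :=
    Finset.mul_mem_mul (mem_starPiece.2 ⟨y, hy, rfl⟩) hb
  have ht' : Equiv.swap N N * b ∈ starPiece E₂ N * L₂ :=
    Finset.mul_mem_mul (mem_starPiece.2 ⟨N, hN, rfl⟩) hb
  have hu : Equiv.swap e N * c ∈ starPiece E₃ N * L₃ :=
    Finset.mul_mem_mul (mem_starPiece.2 ⟨e, he, rfl⟩) hc
  have h2 : Equiv.swap x N * Equiv.swap x y * Equiv.swap x N = Equiv.swap N y :=
    swap_conj_star x N y hxy.symm hyN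
  have hrel : Equiv.swap x N * a * (Equiv.swap x N * a')⁻¹ *
      (Equiv.swap y N * b * (Equiv.swap N N * b)⁻¹) *
      (Equiv.swap e N * c * (Equiv.swap e N * c)⁻¹) = 1 := by
    have step1 : Equiv.swap x N * a * (Equiv.swap x N * a')⁻¹ =
        Equiv.swap x N * (a * a'⁻¹) * Equiv.swap x N := by
      rw [mul_inv_rev, Equiv.swap_inv]; group
    have hNN : Equiv.swap N N = (1 : Equiv.Perm α) := Equiv.swap_self N
    have step2 : Equiv.swap y N * b * (Equiv.swap N N * b)⁻¹ = Equiv.swap y N := by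
      rw [hNN, one_mul, mul_inv_cancel_right]
    rw [step1, step2, mul_inv_cancel, mul_one, hq, h2, Equiv.swap_comm y N, Equiv.swap_mul_self]
  obtain ⟨hss, -, -⟩ := hT _ hs _ hs' _ ht _ ht' _ hu _ hu hrel
  have haa : a = a' := mul_left_cancel hss
  have h3 : Equiv.swap x y = 1 := by rw [← hq, haa, mul_inv_cancel]
  exact hxy (Equiv.swap_eq_one_iff.1 h3)

end Summit.MatrixMultiplication.MatrixMultiplication.Theorems.ThresholdSubsetTriples
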